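import Summits.RiemannHypothesis.RiemannHypothesis.Theorems.WeilFormatCEntryBasis
import HarnessLib

/-!
# Format C, entry theorem (L-C1) — III: the increment form `D_t` and the prime block of a trigonometric window

Helper file of the rh-explicit Weil-positivity programme (`--supports stmt-RiemannHypothesis-0098`; seat
rh-explicit-weil-2), RH-free, no definitions, no named facts.  Continues `WeilFormatCEntryBasis.lean`.

The window form `weilWindowForm a u = P(u) + 𝓔_a(u) − M_a‖u‖²` is built from the increments
`D_t(u) = weilIncrement u t = ∫ |u(x+t) − u(x)|² dx` (prime lengths `t = log k < 2a` with rates `Λ(k)k^{-1/2}`,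
and the archimedean density on `t > 0`).  For a trigonometric window `u = Σ_{n∈s} c_n χ_n` on `[-a, a]`
(`χ_n(x) = (2a)^{-1/2}e^{πinx/a}·1_{[-a,a]}`, `ω_n = πn/a`) we prove, from the shifted overlaps
`∫ χ_m(x+t) conj χ_n(x) dx` (`= e^{iω_n t}(2a−t)/2a` on the diagonal, `(−1)^{n+m}(e^{iω_n t} − e^{iω_m t})/(2π(m−n)i)`
off it, `0` for `t ≥ 2a`; Yoshida's (5.2)/(5.3) are these kernels `F = χ_n ⋆ χ̃_m`):

* `weilIncrement_sum_smul_chi` (`0 ≤ t ≤ 2a`):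
  `D_t(u) = Σ_n Σ_m Re(conj c_n · c_m) K_t(n,m)`, `K_t(n,n) = 2 − 2(1 − t/2a)cos(ω_n t)`,
  `K_t(n,m) = −(−1)^{n+m}(sin ω_m t − sin ω_n t)/(π(n − m))` (`n ≠ m`) — a REAL symmetric kernel;
* `weilIncrement_sum_smul_chi_of_le` (`t ≥ 2a`): `D_t(u) = Σ_n Σ_m Re(conj c_n c_m)·2δ_{nm}`;
* `sum_weilIncrement_sum_smul_chi`: the prime block `Σ_{log k<2a} Λ(k)k^{-1/2} D_{log k}(u)` as the Hermitian form
  of `Σ_k Λ(k)k^{-1/2} K_{log k}(n,m)` — with the `‖u‖²`-part of `M_a` this is the prime sum of Yoshida (5.15)/(5.16)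
  (`K_{ℓ}(n,n) − 2 = −2(1 − ℓ/2a)cos(ω_n ℓ)`).

The archimedean block `∫₀^∞ e^{t/2}/(2 sinh t)·D_t(u) dt` (digamma closed forms) follows in a sibling file.

References: H. Yoshida, Adv. Stud. Pure Math. 21 (1992) 281–325, §5 (5.2)–(5.3) p. 297, (5.15)–(5.16) p. 301
[Yoshida1992HermitianForms]; E. Bombieri, Rend. Mat. Acc. Lincei (9) 11 (2000), Thm 2 [Bombieri2000Weil].
-/

set_option linter.dupNamespace false

noncomputable section

open Complex Set MeasureTheory Finset
open scoped Real ComplexConjugate BigOperators ArithmeticFunction.vonMangoldt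

namespace Summit.RiemannHypothesis.RiemannHypothesis.Theorems.WeilFormatC

open Literature.NumberTheory.LFunctions Literature.NumberTheory.LFunctions.Yoshida1992

variable {a : ℝ}

/-! ## Shifted products of the basis functions -/

/-- For `t ≥ 0`: `x ∈ [-a, a]` and `x + t ∈ [-a, a]` iff `x ∈ [-a, a − t]`. -/
theorem mem_Icc_and_add_mem_Icc_iff {t : ℝ} (ht : 0 ≤ t) {x : ℝ} :
    (x ∈ Icc (-a) a ∧ x + t ∈ Icc (-a) a) ↔ x ∈ Icc (-a) (a - t) := by
  simp only [Set.mem_Icc]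
  constructor
  · rintro ⟨⟨h1, _⟩, _, h4⟩
    exact ⟨h1, by linarith⟩
  · rintro ⟨h1, h2⟩
    exact ⟨⟨h1, by linarith⟩, by linarith, by linarith⟩

/-- `χ_m(x + t) conj(χ_n(x))` is, for `t ≥ 0`, the truncation to `[-a, a − t]` of a continuous function. -/
theorem chi_shift_mul_conj_chi_eq_indicator (m n : ℤ) {t : ℝ} (ht : 0 ≤ t) :
    (fun x ↦ chi a m (x + t) * conj (chi a n x)) =
      (Icc (-a) (a - t)).indicator (fun x ↦ chiCore a m (x + t) * conj (chiCore a n x)) := by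
  funext x
  by_cases hx : x ∈ Icc (-a) (a - t)
  · have h := (mem_Icc_and_add_mem_Icc_iff ht).2 hx
    rw [indicator_of_mem hx, chi_eq_chiCore_of_mem m h.2, chi_eq_chiCore_of_mem n h.1]
  · rw [indicator_of_notMem hx]
    by_cases h1 : x ∈ Icc (-a) a
    · have h2 : x + t ∉ Icc (-a) a := fun h2 ↦ hx ((mem_Icc_and_add_mem_Icc_iff ht).1 ⟨h1, h2⟩)
      rw [chi_apply_of_not_mem m h2, zero_mul]
    · rw [chi_apply_of_not_mem n h1, map_zero, mul_zero]

/-- `χ_m(x) conj(χ_n(x + t))` is, for `t ≥ 0`, the truncation to `[-a, a − t]` of a continuous function. -/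
theorem chi_mul_conj_chi_shift_eq_indicator (m n : ℤ) {t : ℝ} (ht : 0 ≤ t) :
    (fun x ↦ chi a m x * conj (chi a n (x + t))) =
      (Icc (-a) (a - t)).indicator (fun x ↦ chiCore a m x * conj (chiCore a n (x + t))) := by
  funext x
  by_cases hx : x ∈ Icc (-a) (a - t)
  · have h := (mem_Icc_and_add_mem_Icc_iff ht).2 hx
    rw [indicator_of_mem hx, chi_eq_chiCore_of_mem m h.1, chi_eq_chiCore_of_mem n h.2]
  · rw [indicator_of_notMem hx]
    by_cases h1 : x ∈ Icc (-a) a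
    · have h2 : x + t ∉ Icc (-a) a := fun h2 ↦ hx ((mem_Icc_and_add_mem_Icc_iff ht).1 ⟨h1, h2⟩)
      rw [chi_apply_of_not_mem n h2, map_zero, mul_zero]
    · rw [chi_apply_of_not_mem m h1, zero_mul]

/-- Integrability of `χ_m(x + t) conj(χ_n(x))`, `t ≥ 0`. -/
theorem integrable_chi_shift_mul_conj_chi (m n : ℤ) {t : ℝ} (ht : 0 ≤ t) :
    Integrable (fun x ↦ chi a m (x + t) * conj (chi a n x)) := by
  rw [chi_shift_mul_conj_chi_eq_indicator m n ht]
  exact ((((continuous_chiCore a m).comp (continuous_id.add continuous_const)).mul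
    (Complex.continuous_conj.comp (continuous_chiCore a n))).continuousOn.integrableOn_Icc).integrable_indicator
      measurableSet_Icc

/-- Integrability of `χ_m(x) conj(χ_n(x + t))`, `t ≥ 0`. -/
theorem integrable_chi_mul_conj_chi_shift (m n : ℤ) {t : ℝ} (ht : 0 ≤ t) :
    Integrable (fun x ↦ chi a m x * conj (chi a n (x + t))) := by
  rw [chi_mul_conj_chi_shift_eq_indicator m n ht]
  exact (((continuous_chiCore a m).mul (Complex.continuous_conj.comp
    ((continuous_chiCore a n).comp (continuous_id.add continuous_const)))).continuousOn.integrableOn_Icc).integrable_indicator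
      measurableSet_Icc

/-- The product of a shifted and an unshifted core exponential:
`χ_m^{core}(x+t) conj(χ_n^{core}(x)) = (2a)^{-1} e^{πimt/a} e^{πi(m−n)x/a}`. -/
theorem chiCore_shift_mul_conj_chiCore (ha : 0 < a) (m n : ℤ) (t x : ℝ) :
    chiCore a m (x + t) * conj (chiCore a n x) =
      ((1 / (2 * a) : ℝ) : ℂ) * cexp (π * I * m * t / a) * cexp ((π * I * (m - n) / a) * x) := by
  simp only [chiCore]
  rw [map_mul, Complex.conj_ofReal, ← Complex.exp_conj]
  have hc : conj (π * I * n * (x : ℂ) / a : ℂ) = -(π * I * n * x / a) := by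
    simp only [map_div₀, map_mul, Complex.conj_ofReal, Complex.conj_I, map_intCast]; ring
  rw [hc]
  have hsq : ((1 / Real.sqrt (2 * a) : ℝ) : ℂ) * ((1 / Real.sqrt (2 * a) : ℝ) : ℂ) =
      ((1 / (2 * a) : ℝ) : ℂ) := by
    rw [← Complex.ofReal_mul, div_mul_div_comm, one_mul, Real.mul_self_sqrt (by positivity)]
  calc ((1 / Real.sqrt (2 * a) : ℝ) : ℂ) * cexp (π * I * m * ((x + t : ℝ) : ℂ) / a) *
        (((1 / Real.sqrt (2 * a) : ℝ) : ℂ) * cexp (-(π * I * n * x / a)))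
      = (((1 / Real.sqrt (2 * a) : ℝ) : ℂ) * ((1 / Real.sqrt (2 * a) : ℝ) : ℂ)) *
          (cexp (π * I * m * ((x + t : ℝ) : ℂ) / a) * cexp (-(π * I * n * x / a))) := by ring
    _ = ((1 / (2 * a) : ℝ) : ℂ) * cexp (π * I * m * t / a + (π * I * (m - n) / a) * x) := by
        rw [hsq, ← Complex.exp_add]
        congr 2
        push_cast
        ring
    _ = _ := by rw [Complex.exp_add]; ring

/-- `e^{πimt/a}` in the polar shape `e^{iω_m t}`. -/
theorem cexp_freq_eq (a : ℝ) (m : ℤ) (t : ℝ) :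
    cexp (π * I * m * t / a) = cexp (((π * m / a : ℝ) : ℂ) * t * I) := by
  congr 1; push_cast; ring

/-- `(-1)^(m-n) = (-1)^(n+m)` in `ℂ`. -/
theorem neg_one_zpow_sub_eq_add (m n : ℤ) : (-1 : ℂ) ^ (m - n) = (-1) ^ (n + m) := by
  have hiff : Even (m - n) ↔ Even (n + m) := by
    rw [Int.even_sub, Int.even_add]; tauto
  rcases Int.even_or_odd (m - n) with h | h
  · rw [h.neg_one_zpow, (hiff.1 h).neg_one_zpow]
  · have h' : Odd (n + m) := by
      rcases Int.even_or_odd (n + m) with h2 | h2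
      · exact absurd (hiff.2 h2) (Int.not_even_iff_odd.2 h)
      · exact h2
    rw [h.neg_one_zpow, h'.neg_one_zpow]

/-- **Shifted overlap, diagonal** (`0 ≤ t ≤ 2a`): `∫_ℝ χ_n(x+t) conj(χ_n(x)) dx = e^{iω_n t} (2a − t)/(2a)`. -/
theorem integral_chi_shift_mul_conj_chi_self (ha : 0 < a) (n : ℤ) {t : ℝ} (ht0 : 0 ≤ t) (ht : t ≤ 2 * a) :
    ∫ x, chi a n (x + t) * conj (chi a n x) =
      cexp (((π * n / a : ℝ) : ℂ) * t * I) * (((2 * a - t) / (2 * a) : ℝ) : ℂ) := by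
  rw [chi_shift_mul_conj_chi_eq_indicator n n ht0, integral_indicator measurableSet_Icc,
    integral_Icc_eq_integral_Ioc, ← intervalIntegral.integral_of_le (by linarith)]
  simp_rw [chiCore_shift_mul_conj_chiCore ha, sub_self, mul_zero, zero_div, zero_mul, Complex.exp_zero, mul_one]
  rw [intervalIntegral.integral_const, cexp_freq_eq]
  simp only [Complex.real_smul]
  push_cast
  field_simp
  ring

/-- **Shifted overlap, off-diagonal** (`0 ≤ t ≤ 2a`, `m ≠ n`):
`∫_ℝ χ_m(x+t) conj(χ_n(x)) dx = (−1)^{n+m} (e^{iω_n t} − e^{iω_m t}) / (2π(m − n) i)`. -/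
theorem integral_chi_shift_mul_conj_chi_of_ne (ha : 0 < a) {m n : ℤ} (hmn : m ≠ n) {t : ℝ} (ht0 : 0 ≤ t)
    (ht : t ≤ 2 * a) :
    ∫ x, chi a m (x + t) * conj (chi a n x) =
      (-1) ^ (n + m) * (cexp (((π * n / a : ℝ) : ℂ) * t * I) - cexp (((π * m / a : ℝ) : ℂ) * t * I)) /
        (((2 * π * (m - n) : ℝ) : ℂ) * I) := by
  rw [chi_shift_mul_conj_chi_eq_indicator m n ht0, integral_indicator measurableSet_Icc,
    integral_Icc_eq_integral_Ioc, ← intervalIntegral.integral_of_le (by linarith)]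
  simp_rw [chiCore_shift_mul_conj_chiCore ha]
  have ha' : (a : ℂ) ≠ 0 := by exact_mod_cast ha.ne'
  have hmn' : ((m : ℂ) - n) ≠ 0 := by
    rw [sub_ne_zero]; exact_mod_cast hmn
  have hc : (π * I * (m - n) / a : ℂ) ≠ 0 :=
    div_ne_zero (mul_ne_zero (mul_ne_zero (by exact_mod_cast Real.pi_ne_zero) I_ne_zero) hmn') ha'
  rw [intervalIntegral.integral_const_mul, integral_exp_mul_complex hc]
  -- endpoint values
  have hk : (π * I * (m - n) : ℂ) = π * I * ((m - n : ℤ) : ℂ) := by push_cast; ring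
  have h1 : cexp (π * I * (m - n) / a * ((a - t : ℝ) : ℂ)) =
      (-1) ^ (n + m) * cexp (-(π * I * (m - n) / a * t)) := by
    rw [show π * I * (m - n) / a * ((a - t : ℝ) : ℂ) = π * I * ((m - n : ℤ) : ℂ) + -(π * I * (m - n) / a * t) by
      push_cast; field_simp; ring, Complex.exp_add, cexp_pi_mul_I_mul_int, neg_one_zpow_sub_eq_add]
  have h2 : cexp (π * I * (m - n) / a * ((-a : ℝ) : ℂ)) = (-1) ^ (n + m) := by
    rw [show π * I * (m - n) / a * ((-a : ℝ) : ℂ) = π * I * ((-(m - n) : ℤ) : ℂ) by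
      push_cast; field_simp, cexp_pi_mul_I_mul_int, neg_one_zpow_neg, neg_one_zpow_sub_eq_add]
  rw [h1, h2]
  -- the three exponentials in polar shape
  have e1 : cexp (π * I * m * t / a) * cexp (-(π * I * (m - n) / a * t)) = cexp (((π * n / a : ℝ) : ℂ) * t * I) := by
    rw [← Complex.exp_add]; congr 1; push_cast; field_simp; ring
  have e2 : cexp (π * I * m * t / a) = cexp (((π * m / a : ℝ) : ℂ) * t * I) := cexp_freq_eq a m t
  rw [show ((1 / (2 * a) : ℝ) : ℂ) * cexp (π * I * m * t / a) *
      (((-1) ^ (n + m) * cexp (-(π * I * (m - n) / a * t)) - (-1) ^ (n + m)) / (π * I * (m - n) / a)) =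
      ((1 / (2 * a) : ℝ) : ℂ) * (-1) ^ (n + m) *
        (cexp (π * I * m * t / a) * cexp (-(π * I * (m - n) / a * t)) - cexp (π * I * m * t / a)) /
          (π * I * (m - n) / a) by ring, e1, e2]
  push_cast
  field_simp

/-- **Shifted overlap beyond the window** (`t ≥ 2a`): `∫_ℝ χ_m(x+t) conj(χ_n(x)) dx = 0`. -/
theorem integral_chi_shift_mul_conj_chi_of_le (ha : 0 < a) (m n : ℤ) {t : ℝ} (ht : 2 * a ≤ t) :
    ∫ x, chi a m (x + t) * conj (chi a n x) = 0 := by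
  rw [chi_shift_mul_conj_chi_eq_indicator m n (by linarith), integral_indicator measurableSet_Icc,
    integral_Icc_eq_integral_Ioc, Set.Ioc_eq_empty (by intro h; linarith), setIntegral_empty]

/-- Shifting both factors changes nothing: `∫_ℝ χ_m(x+t) conj(χ_n(x+t)) dx = δ_{mn}`. -/
theorem integral_chi_shift_mul_conj_chi_shift (ha : 0 < a) (m n : ℤ) (t : ℝ) :
    ∫ x, chi a m (x + t) * conj (chi a n (x + t)) = if m = n then 1 else 0 := by
  rw [integral_add_right_eq_self (fun x ↦ chi a m x * conj (chi a n x)) t, integral_chi_mul_conj_chi ha]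

/-- `∫_ℝ χ_m(x) conj(χ_n(x+t)) dx = conj ∫_ℝ χ_n(x+t) conj(χ_m(x)) dx`. -/
theorem integral_chi_mul_conj_chi_shift (m n : ℤ) (t : ℝ) :
    ∫ x, chi a m x * conj (chi a n (x + t)) = conj (∫ x, chi a n (x + t) * conj (chi a m x)) := by
  rw [← integral_conj]
  congr 1 with x
  rw [map_mul, Complex.conj_conj, mul_comm]

/-- **The increment pairing** `∫_ℝ (χ_m(x+t) − χ_m(x)) conj(χ_n(x+t) − χ_n(x)) dx
 = 2δ_{mn} − ∫ χ_m(·+t) conj χ_n − conj ∫ χ_n(·+t) conj χ_m` (`t ≥ 0`). -/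
theorem integral_incr_mul_conj_incr (ha : 0 < a) (m n : ℤ) {t : ℝ} (ht : 0 ≤ t) :
    ∫ x, (chi a m (x + t) - chi a m x) * conj (chi a n (x + t) - chi a n x) =
      2 * (if m = n then 1 else 0) - (∫ x, chi a m (x + t) * conj (chi a n x)) -
        conj (∫ x, chi a n (x + t) * conj (chi a m x)) := by
  have hpt : ∀ x, (chi a m (x + t) - chi a m x) * conj (chi a n (x + t) - chi a n x) =
      chi a m (x + t) * conj (chi a n (x + t)) - chi a m (x + t) * conj (chi a n x) -
        chi a m x * conj (chi a n (x + t)) + chi a m x * conj (chi a n x) := by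
    intro x; rw [map_sub]; ring
  simp_rw [hpt]
  have iA : Integrable fun x ↦ chi a m (x + t) * conj (chi a n (x + t)) :=
    (integrable_chi_mul_conj_chi m n).comp_add_right t
  have iB := integrable_chi_shift_mul_conj_chi (a := a) m n ht
  have iC := integrable_chi_mul_conj_chi_shift (a := a) m n ht
  have iD := integrable_chi_mul_conj_chi (a := a) m n
  have iAB : Integrable fun x ↦ chi a m (x + t) * conj (chi a n (x + t)) - chi a m (x + t) * conj (chi a n x) :=
    iA.sub iB
  have iABC : Integrable fun x ↦ chi a m (x + t) * conj (chi a n (x + t)) - chi a m (x + t) * conj (chi a n x) -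
      chi a m x * conj (chi a n (x + t)) := iAB.sub iC
  rw [integral_add iABC iD, integral_sub iAB iC, integral_sub iA iB,
    integral_chi_shift_mul_conj_chi_shift ha, integral_chi_mul_conj_chi_shift, integral_chi_mul_conj_chi ha]
  ring

/-! ## The increment form `D_t` of a trigonometric window -/

/-- `D_t(Σ c_n χ_n) = Σ_n Σ_m Re( conj c_n · c_m · ∫ (χ_m(x+t) − χ_m(x)) conj(χ_n(x+t) − χ_n(x)) dx )` (any `t ≥ 0`). -/
theorem weilIncrement_sum_smul_chi_eq (s : Finset ℤ) (c : ℤ → ℂ) {t : ℝ} (ht : 0 ≤ t) :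
    weilIncrement (∑ n ∈ s, c n • chi a n) t =
      ∑ n ∈ s, ∑ m ∈ s, (conj (c n) * c m *
        ∫ x, (chi a m (x + t) - chi a m x) * conj (chi a n (x + t) - chi a n x)).re := by
  have h : ∀ z : ℂ, ‖z‖ ^ 2 = (conj z * z).re := fun z ↦ by
    rw [Complex.conj_mul']; norm_cast
  have hpt : ∀ x, ‖(∑ n ∈ s, c n • chi a n) (x + t) - (∑ n ∈ s, c n • chi a n) x‖ ^ 2 =
      (∑ n ∈ s, ∑ m ∈ s, conj (c n) * c m *
        ((chi a m (x + t) - chi a m x) * conj (chi a n (x + t) - chi a n x))).re := by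
    intro x
    rw [h, sum_smul_chi_apply, sum_smul_chi_apply, ← Finset.sum_sub_distrib, map_sum, Finset.sum_mul_sum]
    congr 1
    refine Finset.sum_congr rfl fun n _ ↦ Finset.sum_congr rfl fun m _ ↦ ?_
    simp only [map_sub, map_mul]; ring
  have hint : ∀ n m : ℤ, Integrable fun x ↦ conj (c n) * c m *
      ((chi a m (x + t) - chi a m x) * conj (chi a n (x + t) - chi a n x)) := by
    intro n m
    refine Integrable.const_mul ?_ _
    have hpt' : ∀ x, (chi a m (x + t) - chi a m x) * conj (chi a n (x + t) - chi a n x) =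
        chi a m (x + t) * conj (chi a n (x + t)) - chi a m (x + t) * conj (chi a n x) -
          chi a m x * conj (chi a n (x + t)) + chi a m x * conj (chi a n x) := by
      intro x; rw [map_sub]; ring
    simp_rw [hpt']
    exact ((((integrable_chi_mul_conj_chi m n).comp_add_right t).sub
      (integrable_chi_shift_mul_conj_chi m n ht)).sub (integrable_chi_mul_conj_chi_shift m n ht)).add
        (integrable_chi_mul_conj_chi m n)
  unfold weilIncrement
  simp_rw [hpt]
  have hInt : Integrable (fun x ↦ ∑ n ∈ s, ∑ m ∈ s, conj (c n) * c m *
      ((chi a m (x + t) - chi a m x) * conj (chi a n (x + t) - chi a n x))) :=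
    integrable_finsetSum s fun n _ ↦ integrable_finsetSum s fun m _ ↦ hint n m
  have hre := integral_re hInt
  simp only [RCLike.re_to_complex] at hre
  rw [hre, integral_finsetSum _ fun n _ ↦ integrable_finsetSum _ fun m _ ↦ hint n m, Complex.re_sum]
  refine Finset.sum_congr rfl fun n _ ↦ ?_
  rw [integral_finsetSum _ fun m _ ↦ hint n m, Complex.re_sum]
  refine Finset.sum_congr rfl fun m _ ↦ ?_
  rw [integral_const_mul]

/-- The increment pairing in closed REAL form on the window scale `0 ≤ t ≤ 2a`:
`2 − 2(1 − t/2a)cos(ω_n t)` on the diagonal, `−(−1)^{n+m}(sin ω_m t − sin ω_n t)/(π(n−m))` off it. -/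
theorem integral_incr_mul_conj_incr_eq (ha : 0 < a) (m n : ℤ) {t : ℝ} (ht0 : 0 ≤ t) (ht : t ≤ 2 * a) :
    ∫ x, (chi a m (x + t) - chi a m x) * conj (chi a n (x + t) - chi a n x) =
      ((if n = m then 2 - 2 * (1 - t / (2 * a)) * Real.cos (π * n / a * t)
        else -(-1 : ℝ) ^ (n + m) * (Real.sin (π * m / a * t) - Real.sin (π * n / a * t)) / (π * (n - m)) : ℝ) : ℂ) := by
  rw [integral_incr_mul_conj_incr ha m n ht0]
  by_cases hmn : m = n
  · subst hmn
    rw [if_pos rfl, if_pos rfl, integral_chi_shift_mul_conj_chi_self ha m ht0 ht]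
    have ha' : (a : ℂ) ≠ 0 := by exact_mod_cast ha.ne'
    set θ : ℝ := π * m / a * t with hθ
    have hE : cexp (((π * m / a : ℝ) : ℂ) * t * I) = (Real.cos θ : ℂ) + (Real.sin θ : ℂ) * I := by
      rw [show ((π * m / a : ℝ) : ℂ) * t * I = (θ : ℂ) * I by rw [hθ]; push_cast; ring,
        Complex.exp_mul_I, ← Complex.ofReal_cos, ← Complex.ofReal_sin]
    rw [hE]
    simp only [map_mul, map_add, Complex.conj_ofReal, Complex.conj_I]
    push_cast
    field_simp
    ring
  · rw [if_neg hmn, if_neg (Ne.symm hmn), integral_chi_shift_mul_conj_chi_of_ne ha hmn ht0 ht,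
      integral_chi_shift_mul_conj_chi_of_ne ha (Ne.symm hmn) ht0 ht]
    set θn : ℝ := π * n / a * t with hθn
    set θm : ℝ := π * m / a * t with hθm
    have hEn : cexp (((π * n / a : ℝ) : ℂ) * t * I) = (Real.cos θn : ℂ) + (Real.sin θn : ℂ) * I := by
      rw [show ((π * n / a : ℝ) : ℂ) * t * I = (θn : ℂ) * I by rw [hθn]; push_cast; ring,
        Complex.exp_mul_I, ← Complex.ofReal_cos, ← Complex.ofReal_sin]
    have hEm : cexp (((π * m / a : ℝ) : ℂ) * t * I) = (Real.cos θm : ℂ) + (Real.sin θm : ℂ) * I := by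
      rw [show ((π * m / a : ℝ) : ℂ) * t * I = (θm : ℂ) * I by rw [hθm]; push_cast; ring,
        Complex.exp_mul_I, ← Complex.ofReal_cos, ← Complex.ofReal_sin]
    rw [hEn, hEm]
    have hconj1 : conj ((-1 : ℂ) ^ (m + n)) = (-1) ^ (m + n) := by
      rw [map_zpow₀, map_neg, map_one]
    simp only [map_mul, map_div₀, map_sub, map_add, Complex.conj_ofReal, Complex.conj_I, hconj1]
    have hd1 : (((2 * π * (m - n) : ℝ) : ℂ) * I) ≠ 0 := by
      refine mul_ne_zero ?_ I_ne_zero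
      have : (2 * π * (m - n) : ℝ) ≠ 0 := by
        have : (m : ℝ) - n ≠ 0 := by rw [sub_ne_zero]; exact_mod_cast hmn
        positivity
      exact_mod_cast this
    have hd2 : (((2 * π * (n - m) : ℝ) : ℂ) * -I) ≠ 0 := by
      refine mul_ne_zero ?_ (neg_ne_zero.2 I_ne_zero)
      have : (2 * π * (n - m) : ℝ) ≠ 0 := by
        have : (n : ℝ) - m ≠ 0 := by rw [sub_ne_zero]; exact_mod_cast (Ne.symm hmn)
        positivity
      exact_mod_cast this
    have hpi : (π : ℂ) ≠ 0 := by exact_mod_cast Real.pi_ne_zero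
    have hnm : ((n : ℂ) - m) ≠ 0 := by rw [sub_ne_zero]; exact_mod_cast (Ne.symm hmn)
    have hmn' : ((m : ℂ) - n) ≠ 0 := by rw [sub_ne_zero]; exact_mod_cast hmn
    push_cast
    simp only [zpow_add₀ (by norm_num : (-1 : ℂ) ≠ 0)]
    field_simp
    ring

/-- **`D_t` of a trigonometric window on the window scale** (`0 ≤ t ≤ 2a`), as the Hermitian form of the REAL
symmetric kernel `K_t(n,n) = 2 − 2(1 − t/2a) cos(ω_n t)`, `K_t(n,m) = −(−1)^{n+m}(sin ω_m t − sin ω_n t)/(π(n−m))`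
(`ω_n = πn/a`; Yoshida's (5.2)/(5.3) integrated: `D_t(u) = 2‖u‖² − (F(t) + F(−t))`, `F = u ⋆ ũ`). -/
theorem weilIncrement_sum_smul_chi (ha : 0 < a) (s : Finset ℤ) (c : ℤ → ℂ) {t : ℝ} (ht0 : 0 ≤ t)
    (ht : t ≤ 2 * a) :
    weilIncrement (∑ n ∈ s, c n • chi a n) t =
      ∑ n ∈ s, ∑ m ∈ s, (conj (c n) * c m).re *
        (if n = m then 2 - 2 * (1 - t / (2 * a)) * Real.cos (π * n / a * t)
         else -(-1 : ℝ) ^ (n + m) * (Real.sin (π * m / a * t) - Real.sin (π * n / a * t)) / (π * (n - m))) := by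
  rw [weilIncrement_sum_smul_chi_eq s c ht0]
  refine Finset.sum_congr rfl fun n _ ↦ Finset.sum_congr rfl fun m _ ↦ ?_
  rw [integral_incr_mul_conj_incr_eq ha m n ht0 ht, Complex.re_mul_ofReal]

/-- **`D_t` beyond the window scale** (`t ≥ 2a`): `D_t(Σ c_n χ_n) = Σ_n Σ_m Re(conj c_n c_m)·2δ_{nm} = 2 Σ |c_n|²`. -/
theorem weilIncrement_sum_smul_chi_of_le (ha : 0 < a) (s : Finset ℤ) (c : ℤ → ℂ) {t : ℝ} (ht : 2 * a ≤ t) :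
    weilIncrement (∑ n ∈ s, c n • chi a n) t =
      ∑ n ∈ s, ∑ m ∈ s, (conj (c n) * c m).re * (if n = m then 2 else 0) := by
  rw [weilIncrement_sum_smul_chi_eq s c (by linarith)]
  refine Finset.sum_congr rfl fun n _ ↦ Finset.sum_congr rfl fun m _ ↦ ?_
  rw [integral_incr_mul_conj_incr ha m n (by linarith), integral_chi_shift_mul_conj_chi_of_le ha m n ht,
    integral_chi_shift_mul_conj_chi_of_le ha n m ht, map_zero, sub_zero, sub_zero]
  by_cases hmn : m = n
  · subst hmn
    rw [if_pos rfl, if_pos rfl, show (2 : ℂ) * 1 = ((2 : ℝ) : ℂ) by norm_num, Complex.re_mul_ofReal]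
  · rw [if_neg hmn, if_neg (Ne.symm hmn), mul_zero, mul_zero, mul_zero, Complex.zero_re]

/-- **The prime block of the window form**: lengths `log k < 2a` lie on the window scale, so
`Σ_{log k < 2a} Λ(k) k^{-1/2} D_{log k}(Σ c_n χ_n) = Σ_n Σ_m Re(conj c_n c_m) Σ_{log k < 2a} Λ(k) k^{-1/2} K_{log k}(n,m)`
(Yoshida (5.15)/(5.16), the sums over `p, e` with `e log N(p) ≤ 2a`, before subtracting the `‖u‖²` part). -/
theorem sum_weilIncrement_sum_smul_chi (ha : 0 < a) (s : Finset ℤ) (c : ℤ → ℂ) :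
    ∑ k ∈ weilPrimeIndex a, (Λ k : ℝ) / Real.sqrt k * weilIncrement (∑ n ∈ s, c n • chi a n) (Real.log k) =
      ∑ n ∈ s, ∑ m ∈ s, (conj (c n) * c m).re *
        ∑ k ∈ weilPrimeIndex a, (Λ k : ℝ) / Real.sqrt k *
          (if n = m then 2 - 2 * (1 - Real.log k / (2 * a)) * Real.cos (π * n / a * Real.log k)
           else -(-1 : ℝ) ^ (n + m) * (Real.sin (π * m / a * Real.log k) - Real.sin (π * n / a * Real.log k)) /
             (π * (n - m))) := by
  have hk : ∀ k ∈ weilPrimeIndex a, 0 ≤ Real.log k ∧ Real.log k ≤ 2 * a := fun k hk ↦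
    ⟨Real.log_natCast_nonneg k, (mem_weilPrimeIndex.1 hk).le⟩
  rw [Finset.sum_congr rfl fun k hk' ↦ by rw [weilIncrement_sum_smul_chi ha s c (hk k hk').1 (hk k hk').2]]
  simp_rw [Finset.mul_sum]
  rw [Finset.sum_comm]
  refine Finset.sum_congr rfl fun n _ ↦ ?_
  rw [Finset.sum_comm]
  refine Finset.sum_congr rfl fun m _ ↦ Finset.sum_congr rfl fun k _ ↦ ?_
  ring

end Summit.RiemannHypothesis.RiemannHypothesis.Theorems.WeilFormatC
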